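import Mathlib
import HarnessLib
import Literature.MathematicalPhysics.QuantumLattice.FermiRG.BGM2006AppA3Reduction
import Summits.HubbardSuperconductivity.HubbardSuperconductivity.Theorems.KLProgrammeAbsUmklappTargetCountPrescribedFrameAbs
import Summits.HubbardSuperconductivity.HubbardSuperconductivity.Theorems.KLProgrammeH10TwoPointLimitKlAnisoSupportChart
import Summits.HubbardSuperconductivity.HubbardSuperconductivity.Theorems.KLProgrammeH10TwoPointLimitKlAnisoAncestor
import Summits.HubbardSuperconductivity.HubbardSuperconductivity.Theorems.KLProgrammeH10TwoPointLimitKlAnisoAnchoredSectorCountThin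
import Summits.HubbardSuperconductivity.HubbardSuperconductivity.Theorems.KLProgrammeH10TwoPointLimitFrameTorusBridge

/-!
# Route `KLProgramme` — K3 engine child `KLRegimeEngineV17F2` (stmt-HubbardSuperconductivity-20437), stub (b) (ℓ)/(I2)–(I3), located item «ABS-UMK-COUNT»:
# THE KEYED ABSOLUTE COUNT — the number of admissible fine label tuples of `klAnisoFamily … J′` with a prescribed leg set `E` is
# `≤ D^{m+1} · (2^{J′})^{(m+1) − |E| − 2}`, umklapp strings INCLUDED, for every frame of a level window (BGM 2003 Lemma 3.1 with a target, in the engine's vocabulary)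

Cell gate-hubbard-kl, seat p4 g16 (memo HOME/prover-p4/ABS-UMK-COUNT-THEOREM.md §4(b), HOME/prover-p4/UV-REMEASURE-COUNT.md §4; the `k′ = 0` summand of E1's
`(Hμ)` row under decision (b) «COUNTING»).  k3c2-p3's jump lemma `EngineV8.klLevNormOf_jump_le_of_consts` (…EngineTowerRemeasureLev §2) takes the number of
fine label tuples `σ″ ∈ bgmSectorSet L M (klAnisoFamily … J′) (m+1)` with prescribed legs `σ″|_E = τ″|_E` (refining a coarse tuple `σ′` leg by leg) as
the counting hypothesis `hcnt`; so far it is discharged LAST-LEG (`EngineV8.card_relCount_prescribed_lastLeg_klAniso_le`, exponent `(m+1) − |E| − 1`), which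
is flat against E1's allowance at the scale-`0` re-measurement (UV-REMEASURE-COUNT §2).  This file supplies the ABSOLUTE count with the SECOND conservation
gain, uniformly over the umklapp-active strings: the frame capstone `frame_count_target_abs_prescribed_shell` (BGM 2003 Lemma 3.1 with a target vector
`R = 2πG`, prescribed leg set, no near-fibre loss, shell `klE0`) read through the support-to-chart dictionary `rep_mem_sSector2003_of_klAnisoFamily`,
sign absorption by the half-turn (`signedMom_mem_sSector2003`), and the finitely many reciprocal vectors `G` (`|G|_∞ ≤ m+1`,
`exists_sum_signed_torusCentredMomentum_eq`):

* **`card_absCount_prescribed_klAniso_le_frame`** — for every level window with `-4 < μ₁ − 4·klE0`, `μ₂ + 4·klE0 < 0` there are `κ, D > 0` such that for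
  every frame `K` with `4A ≤ κ`, `μ ∈ [μ₁, μ₂]`, torus `L`, cutoff `M`, `β`, `m`, `J′`, every `A″ ⊆ bgmSectorSet L M (klAnisoFamily L M β μ K klE0 J′) (m+1)`
  and every leg set `E` with `|E| + 5 ≤ m + 1` and prescribed labels `τ″|_E`:
  `#{σ″ ∈ A″ : σ″|_E = τ″|_E} ≤ D^{m+1} · (2^{J′})^{(m+1) − |E| − 2}`;
* **`card_relCount_prescribed_absUmklapp_klAniso_le_frame`** — the same bound for the LITERAL filter of `hcnt` (refinement of a coarse tuple `σ′` of any
  scale `k ≤ J′`, same spin and charge), by monotonicity — a drop-in for the last-leg row with exponent `(m+1) − |E| − 2` when `|E| + 5 ≤ m + 1`.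

Everything is PROVED; no definitions, no named facts; nothing here asserts anything about the model or superconductivity.
References: BGM 2006 §2.7–§2.8 (2.66)–(2.73), (2.82)–(2.84), App. A3 [cite: BenfattoGiulianiMastropietro2006]; BGM 2003 §3.1 Lemma 3.1 (4.3), §7.4
[cite: BenfattoGiulianiMastropietro2003].
-/

noncomputable section

namespace Summit.HubbardSuperconductivity.HubbardSuperconductivity.Theorems.PerturbedFermiCurve

set_option linter.dupNamespace false -- summit = problem name (single-conjunct summit), D-0017

open Classical
open Real Set Finset
open Literature.MathematicalPhysics.QuantumLattice Literature.MathematicalPhysics.QuantumLattice.BandSectorCounting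
open Literature.MathematicalPhysics.QuantumLattice.FermiRG Literature.MathematicalPhysics.QuantumLattice.FermiRG.BGM2003
open Literature.MathematicalPhysics.QuantumLattice.FermiRG.BGM2006AppA (signedMom_mem_sSector2003)
open Literature.Probability.LatticeModels
open Summit.HubbardSuperconductivity.HubbardSuperconductivity.Theorems.DispersionFlow
open Summit.HubbardSuperconductivity.HubbardSuperconductivity.Theorems.KLRegimeSplit
open Summit.HubbardSuperconductivity.HubbardSuperconductivity.Theorems.KLProgrammeLegKernels
open Summit.HubbardSuperconductivity.HubbardSuperconductivity.Theorems.TorusFourierL2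

/-- The spin/charge patterns of `m + 1` legs number `4^{m+1}`. [folklore] -/
theorem card_fun_fin_two_prod (m : ℕ) : Fintype.card (Fin (m + 1) → Fin 2 × Fin 2) = 4 ^ (m + 1) := by
  rw [Fintype.card_fun, Fintype.card_prod, Fintype.card_fin, Fintype.card_fin]

/-- The reciprocal vectors `G ∈ ℤ²` with `|G|_∞ ≤ m + 1` number `(2m+3)² ≤ 9·4^{m+1}`. [folklore] -/
theorem card_piFinset_Icc_le (m : ℕ) :
    (((Fintype.piFinset fun _ : Fin 2 => Finset.Icc (-((m : ℤ) + 1)) ((m : ℤ) + 1)).card : ℕ) : ℝ) ≤ 9 * 4 ^ (m + 1) := by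
  have h1 : (Finset.Icc (-((m : ℤ) + 1)) ((m : ℤ) + 1)).card = 2 * m + 3 := by
    rw [Int.card_Icc]; omega
  rw [Fintype.card_piFinset, Finset.prod_const, Finset.card_univ, Fintype.card_fin, h1]
  push_cast
  have hm : ((m : ℝ) + 1) ≤ (2 : ℝ) ^ (m + 1) := by exact_mod_cast (Nat.lt_two_pow_self (n := m + 1)).le
  have h4 : (4 : ℝ) ^ (m + 1) = ((2 : ℝ) ^ (m + 1)) ^ 2 := by rw [← pow_mul, mul_comm, pow_mul]; norm_num
  rw [h4]
  have hm0 : (0 : ℝ) ≤ (m : ℝ) + 1 := by positivity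
  nlinarith [mul_le_mul hm hm hm0 (by positivity)]

/-- **THE KEYED ABSOLUTE COUNT with a prescribed leg set, exponent `(m+1) − |E| − 2`, umklapp strings included** (BGM 2003 Lemma 3.1 with a target, in the
engine's vocabulary; see the module docstring). [cite: BenfattoGiulianiMastropietro2006, App. A3 Lemma A3.1; BenfattoGiulianiMastropietro2003, §3.1 Lemma 3.1 (4.3), §7.4] -/
theorem card_absCount_prescribed_klAniso_le_frame :
    ∀ μ₁ μ₂ : ℝ, -4 < μ₁ - 4 * klE0 → μ₁ ≤ μ₂ → μ₂ + 4 * klE0 < 0 →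
      ∃ κ : ℝ, 0 < κ ∧ ∃ D : ℝ, 0 < D ∧
      ∀ (K : TrigPolyC4v) (A : ℝ), (∀ p : Momentum, ∀ j ≤ 2, ‖iteratedFDeriv ℝ j (frameShift K) p‖ ≤ A) → 4 * A ≤ κ →
      ∀ μ ∈ Set.Icc μ₁ μ₂, ∀ (L M : ℕ) [NeZero L] (β : ℝ) (m J' : ℕ),
      ∀ (A'' : Finset (Fin (m + 1) → SectorLeg (sectorCount J'))),
        A'' ⊆ bgmSectorSet L M (klAnisoFamily L M β μ K klE0 J') (m + 1) →
      ∀ (E : Finset (Fin (m + 1))) (τ'' : Fin (m + 1) → SectorLeg (sectorCount J')), E.card + 5 ≤ m + 1 →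
      ((((A''.filter fun σ'' => ∀ e ∈ E, σ'' e = τ'' e).card : ℕ) : ℝ)) ≤
        D ^ (m + 1) * ((2 : ℝ) ^ J') ^ ((m + 1) - E.card - 2) := by
  intro μ₁ μ₂ hμ₁ h12 hμ₂
  have he0 : (0 : ℝ) < klE0 := by norm_num [klE0]
  have hab : μ₁ - 4 * klE0 ≤ μ₂ + 4 * klE0 := by linarith
  obtain ⟨B, -⟩ : ∃ B : BandBounds (μ₁ - 4 * klE0) (μ₂ + 4 * klE0), B = bandBounds hμ₁ hab hμ₂ := ⟨_, rfl⟩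
  have hDt := B.Dtmin_pos
  -- the frame capstone with the engine's shell
  obtain ⟨κc, hκc, c, hc, hcount⟩ := frame_count_target_abs_prescribed_shell μ₁ μ₂ klE0 he0 hμ₁ h12 hμ₂
  obtain ⟨κ, hκdef⟩ : ∃ κ : ℝ, κ = min κc (min B.Dtmin klE0) := ⟨_, rfl⟩
  have hκ0 : 0 < κ := by rw [hκdef]; exact lt_min hκc (lt_min hDt he0)
  have hκ1 : κ ≤ κc := by rw [hκdef]; exact min_le_left _ _
  have hκ3 : κ ≤ B.Dtmin := by rw [hκdef]; exact (min_le_right _ _).trans (min_le_left _ _)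
  have hκ4 : κ ≤ klE0 := by rw [hκdef]; exact (min_le_right _ _).trans (min_le_right _ _)
  refine ⟨κ, hκ0, 144 * c, by positivity, ?_⟩
  intro K A hA hAκ μ hμ L M _ β m J' A'' hA'' E τ'' hE
  have hA0 : 0 ≤ A := le_trans (norm_nonneg _) (hA 0 0 (by norm_num))
  have hADt : 2 * A < B.Dtmin := by linarith
  have hlo : μ₁ - 4 * klE0 ≤ μ - A - klE0 := by linarith [hμ.1]
  have hhi : μ + A + klE0 ≤ μ₂ + 4 * klE0 := by linarith [hμ.2]
  have hπ := Real.pi_pos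
  -- notation: the frame's chart and its antipodal symmetry
  set u : ℝ → ℝ → ℝ := fun ϑ e => perturbedFermiRadius (fun q : Fin 2 → ℝ => frameShift K (WithLp.toLp 2 q)) (μ + e) ϑ with hu
  have hanti : ∀ θ e : ℝ, |e| ≤ klE0 → u (θ + π) e = u θ e := fun θ e _ =>
    perturbedFermiRadius_add_pi (frameShift_toLp_neg K) (μ + e) θ
  set S := A''.filter fun σ'' => ∀ e ∈ E, σ'' e = τ'' e with hSdef
  -- the half-turn index map, the signed fine string of a label tuple, the prescribed string
  set hti : ℕ → Bool → ℕ → ℕ := fun n s j => if s then j else if j < 2 ^ n then j + 2 ^ n else j - 2 ^ n with hhti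
  have hti_lt : ∀ (n : ℕ) (s : Bool) {j : ℕ}, j < sectorCount n → hti n s j < sectorCount n :=
    fun n s j hj => halfTurnIdx_lt s hj
  set Φ : (Fin (m + 1) → SectorLeg (sectorCount J')) → (Fin (m + 1) → Fin (sectorCount J')) :=
    fun σ'' i => ⟨hti J' (decide ((σ'' i).2 = 0)) (σ'' i).1.1, hti_lt J' _ (σ'' i).1.1.isLt⟩ with hΦ
  set τ₀ : Fin (m + 1) → Fin (sectorCount J') := Φ τ'' with hτ₀
  -- the reciprocal vectors and their classes
  set Gset : Finset (Fin 2 → ℤ) := Fintype.piFinset fun _ : Fin 2 => Finset.Icc (-((m : ℤ) + 1)) ((m : ℤ) + 1) with hGset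
  set PG : (Fin 2 → ℤ) → (Fin (m + 1) → SectorLeg (sectorCount J')) → Prop := fun G σ'' =>
    ∃ kf : Fin (m + 1) → FreqMomentum L M, (∀ i, klAnisoFamily L M β μ K klE0 J' (σ'' i).1.1 (kf i) ≠ 0) ∧
      ∀ j : Fin 2, ∑ i, (if (σ'' i).2 = 0 then torusCentredMomentum L (kf i).2 j else -torusCentredMomentum L (kf i).2 j) =
        2 * π * (G j : ℝ) with hPG
  -- (1) COVER: every admissible tuple carries conserving momenta with SOME reciprocal vector `G`, `|G|_∞ ≤ m + 1`
  have hcoverG : S ⊆ Gset.biUnion fun G => S.filter (PG G) := by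
    intro σ'' hσ''
    have hAmem : σ'' ∈ A'' := (mem_filter.1 hσ'').1
    have hmemA := hA'' hAmem
    unfold bgmSectorSet at hmemA
    rw [mem_filter] at hmemA
    obtain ⟨-, kf, hkF, hsum⟩ := hmemA
    obtain ⟨G, hG⟩ := exists_sum_signed_torusCentredMomentum_eq L (fun i => (σ'' i).2) (fun i => (kf i).2) hsum
    have hGmem : G ∈ Gset := by
      rw [hGset, Fintype.mem_piFinset]
      intro j
      rw [Finset.mem_Icc]
      have h1 : |2 * π * (G j : ℝ)| ≤ ((m : ℝ) + 1) * π := by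
        rw [← hG j]
        refine (Finset.abs_sum_le_sum_abs _ _).trans ?_
        calc ∑ i, |(if (σ'' i).2 = 0 then torusCentredMomentum L (kf i).2 j else -torusCentredMomentum L (kf i).2 j)|
            ≤ ∑ _i : Fin (m + 1), π := Finset.sum_le_sum fun i _ => by
                split_ifs
                · exact abs_torusCentredMomentum_le_pi L (kf i).2 j
                · rw [abs_neg]; exact abs_torusCentredMomentum_le_pi L (kf i).2 j
          _ = ((m : ℝ) + 1) * π := by simp
      rw [abs_mul, abs_of_pos (by positivity : (0 : ℝ) < 2 * π)] at h1
      have h2 : |(G j : ℝ)| ≤ (m : ℝ) + 1 := by nlinarith [abs_nonneg (G j : ℝ)]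
      have h3 : |G j| ≤ (m : ℤ) + 1 := by
        have : ((|G j| : ℤ) : ℝ) ≤ (m : ℝ) + 1 := by rw [Int.cast_abs]; exact h2
        exact_mod_cast this
      exact abs_le.1 h3
    exact mem_biUnion.2 ⟨G, hGmem, mem_filter.2 ⟨hσ'', kf, hkF, hG⟩⟩
  -- (2) FIBRES: the class of `G` with a FIXED spin/charge pattern injects into BGM 2003's target strings of `2πG`
  set pat : (Fin (m + 1) → SectorLeg (sectorCount J')) → (Fin (m + 1) → Fin 2 × Fin 2) := fun σ'' i => ((σ'' i).1.2, (σ'' i).2) with hpat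
  set Str : (Fin 2 → ℤ) → Set (Fin (m + 1) → Fin (sectorCount J')) := fun G =>
    {ω : Fin (m + 1) → Fin (sectorCount J') |
      (∀ e ∈ E, ω e = τ₀ e) ∧ ∃ kk : Fin (m + 1) → (Fin 2 → ℝ), (∀ i, kk i ∈ sSector u klE0 J' (ω i : ℕ)) ∧
        ∑ i, kk i = fun j => 2 * π * (G j : ℝ)} with hStr
  have hfibre : ∀ (G : Fin 2 → ℤ) (p : Fin (m + 1) → Fin 2 × Fin 2),
      (((((S.filter (PG G)).filter fun σ'' => pat σ'' = p).card : ℕ) : ℝ)) ≤ Nat.card (Str G) := by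
    intro G p
    set St := (S.filter (PG G)).filter fun σ'' => pat σ'' = p with hSt
    -- the map into the string set
    have hmem : ∀ σ'' ∈ St, Φ σ'' ∈ Str G := by
      intro σ'' hσ''
      rw [hSt, mem_filter, mem_filter, hSdef, mem_filter] at hσ''
      obtain ⟨⟨⟨-, hEσ⟩, kf, hkF, hG⟩, -⟩ := hσ''
      rw [hStr]
      refine ⟨?_, ?_⟩
      · -- the prescribed legs
        intro e he
        rw [hτ₀]
        have h := hEσ e he
        apply Fin.ext
        simp only [hΦ, h]
      · -- the momenta: supports → chart s-sectors, signs absorbed, conservation with target `2πG`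
        refine ⟨fun i => if decide ((σ'' i).2 = 0) then torusCentredMomentum L (kf i).2 else -torusCentredMomentum L (kf i).2,
          fun i => ?_, ?_⟩
        · have hrep := rep_mem_sSector2003_of_klAnisoFamily B hA hADt L M he0 β J' hlo hhi (hkF i)
          exact signedMom_mem_sSector2003 he0.le hanti (decide ((σ'' i).2 = 0)) hrep
        · funext j
          rw [Finset.sum_apply]
          have e : ∀ i, (if decide ((σ'' i).2 = 0) then torusCentredMomentum L (kf i).2
              else -torusCentredMomentum L (kf i).2) j =
              (if (σ'' i).2 = 0 then torusCentredMomentum L (kf i).2 j else -torusCentredMomentum L (kf i).2 j) := by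
            intro i
            by_cases h : (σ'' i).2 = 0
            · rw [decide_eq_true h, if_pos rfl, if_pos h]
            · rw [decide_eq_false h, if_neg Bool.false_ne_true, if_neg h, Pi.neg_apply]
          simp only [e]
          exact hG j
    -- injectivity on the fibre: the spin/charge pattern is fixed, the half-turn map is injective per charge
    have hinj : Set.InjOn Φ (St : Set (Fin (m + 1) → SectorLeg (sectorCount J'))) := by
      intro a ha b hb hab
      rw [Finset.mem_coe, hSt, mem_filter] at ha hb
      have hpa : ∀ i, (a i).1.2 = (p i).1 ∧ (a i).2 = (p i).2 := fun i => by
        have h := congrFun ha.2 i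
        simp only [hpat] at h
        exact ⟨(Prod.ext_iff.1 h).1, (Prod.ext_iff.1 h).2⟩
      have hpb : ∀ i, (b i).1.2 = (p i).1 ∧ (b i).2 = (p i).2 := fun i => by
        have h := congrFun hb.2 i
        simp only [hpat] at h
        exact ⟨(Prod.ext_iff.1 h).1, (Prod.ext_iff.1 h).2⟩
      funext i
      obtain ⟨haspin, hach⟩ := hpa i
      obtain ⟨hbspin, hbch⟩ := hpb i
      have hi := congrArg (fun g => ((g i : Fin (sectorCount J')) : ℕ)) hab
      simp only [hΦ, hhti] at hi
      rw [hach, hbch] at hi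
      have hω : ((a i).1.1 : ℕ) = ((b i).1.1 : ℕ) := halfTurnIdx_injOn _ (a i).1.1.isLt (b i).1.1.isLt hi
      exact Prod.ext (Prod.ext (Fin.ext hω) (haspin.trans hbspin.symm)) (hach.trans hbch.symm)
    -- count
    have hcnt : St.card ≤ Nat.card (Str G) := by
      have h1 : Nat.card (St : Set (Fin (m + 1) → SectorLeg (sectorCount J'))) ≤ Nat.card (Str G) :=
        Nat.card_le_card_of_injective (fun x : (St : Set (Fin (m + 1) → SectorLeg (sectorCount J'))) =>
            (⟨Φ x.1, hmem x.1 x.2⟩ : Str G))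
          (fun x y hxy => Subtype.ext (hinj x.2 y.2 (congrArg Subtype.val hxy)))
      rwa [Nat.card_coe_set_eq, Set.ncard_coe_finset] at h1
    exact_mod_cast hcnt
  -- (3) THE STRING COUNT: the frame capstone at `L = m + 1`, target `2πG`, prescribed string `τ₀|_E`
  have hStrG : ∀ G : Fin 2 → ℤ, (Nat.card (Str G) : ℝ) ≤ c ^ (m + 1) * (2 : ℝ) ^ (J' * ((m + 1) - E.card - 2)) := by
    intro G
    have h := hcount K A hA (hAκ.trans hκ1) μ hμ J' (m + 1) E hE τ₀ (fun j => 2 * π * (G j : ℝ))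
    rw [hStr]
    exact h
  -- (4) SUM over the reciprocal vectors and the spin/charge patterns
  have hclass : ∀ G : Fin 2 → ℤ, ((((S.filter (PG G)).card : ℕ) : ℝ)) ≤ 4 ^ (m + 1) * (c ^ (m + 1) * (2 : ℝ) ^ (J' * ((m + 1) - E.card - 2))) := by
    intro G
    have hfib := card_eq_sum_card_fiberwise (f := pat) (s := S.filter (PG G)) (t := (univ : Finset (Fin (m + 1) → Fin 2 × Fin 2)))
      (fun _ _ => mem_univ _)
    rw [hfib]
    push_cast
    calc ∑ p ∈ (univ : Finset (Fin (m + 1) → Fin 2 × Fin 2)), (((((S.filter (PG G)).filter fun σ'' => pat σ'' = p).card : ℕ) : ℝ))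
        ≤ ∑ _p ∈ (univ : Finset (Fin (m + 1) → Fin 2 × Fin 2)), c ^ (m + 1) * (2 : ℝ) ^ (J' * ((m + 1) - E.card - 2)) :=
          sum_le_sum fun p _ => (hfibre G p).trans (hStrG G)
      _ = 4 ^ (m + 1) * (c ^ (m + 1) * (2 : ℝ) ^ (J' * ((m + 1) - E.card - 2))) := by
          rw [sum_const, nsmul_eq_mul, card_univ, card_fun_fin_two_prod]
          push_cast
          ring
  have hsum : ((S.card : ℕ) : ℝ) ≤ (Gset.card : ℝ) * (4 ^ (m + 1) * (c ^ (m + 1) * (2 : ℝ) ^ (J' * ((m + 1) - E.card - 2)))) := by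
    have h1 : S.card ≤ ∑ G ∈ Gset, (S.filter (PG G)).card := (Finset.card_le_card hcoverG).trans card_biUnion_le
    calc ((S.card : ℕ) : ℝ) ≤ ∑ G ∈ Gset, ((((S.filter (PG G)).card : ℕ) : ℝ)) := by exact_mod_cast h1
      _ ≤ ∑ _G ∈ Gset, 4 ^ (m + 1) * (c ^ (m + 1) * (2 : ℝ) ^ (J' * ((m + 1) - E.card - 2))) := sum_le_sum fun G _ => hclass G
      _ = (Gset.card : ℝ) * (4 ^ (m + 1) * (c ^ (m + 1) * (2 : ℝ) ^ (J' * ((m + 1) - E.card - 2)))) := by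
          rw [sum_const, nsmul_eq_mul]
  have hG9 : (Gset.card : ℝ) ≤ 9 * 4 ^ (m + 1) := card_piFinset_Icc_le m
  have hX : (2 : ℝ) ^ (J' * ((m + 1) - E.card - 2)) = ((2 : ℝ) ^ J') ^ ((m + 1) - E.card - 2) := pow_mul _ _ _
  have h9 : (9 : ℝ) ≤ 9 ^ (m + 1) := le_self_pow₀ (by norm_num) (by omega)
  have h144 : (144 * c) ^ (m + 1) = 9 ^ (m + 1) * (4 ^ (m + 1) * 4 ^ (m + 1)) * c ^ (m + 1) := by
    rw [mul_pow, show (144 : ℝ) = 9 * (4 * 4) by norm_num, mul_pow, mul_pow]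
  rw [← hX, h144]
  calc ((S.card : ℕ) : ℝ) ≤ (Gset.card : ℝ) * (4 ^ (m + 1) * (c ^ (m + 1) * (2 : ℝ) ^ (J' * ((m + 1) - E.card - 2)))) := hsum
    _ ≤ (9 * 4 ^ (m + 1)) * (4 ^ (m + 1) * (c ^ (m + 1) * (2 : ℝ) ^ (J' * ((m + 1) - E.card - 2)))) :=
        mul_le_mul_of_nonneg_right hG9 (by positivity)
    _ = 9 * (4 ^ (m + 1) * 4 ^ (m + 1)) * c ^ (m + 1) * (2 : ℝ) ^ (J' * ((m + 1) - E.card - 2)) := by ring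
    _ ≤ 9 ^ (m + 1) * (4 ^ (m + 1) * 4 ^ (m + 1)) * c ^ (m + 1) * (2 : ℝ) ^ (J' * ((m + 1) - E.card - 2)) := by
        have h0 : (0 : ℝ) ≤ (4 ^ (m + 1) * 4 ^ (m + 1)) * c ^ (m + 1) * (2 : ℝ) ^ (J' * ((m + 1) - E.card - 2)) := by positivity
        nlinarith [h0, h9]

/-- **The keyed absolute count for the LITERAL filter of k3c2-p3's `hcnt`** (refinements of a coarse tuple `σ′` of scale `k ≤ J′`, same spin and charge,
prescribed legs `σ″|_E = τ″|_E`): the refinement clause only shrinks the set, so for `|E| + 5 ≤ m + 1` the same bound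
`D^{m+1} · (2^{J′})^{(m+1) − |E| − 2}` holds — a drop-in for `EngineV8.card_relCount_prescribed_lastLeg_klAniso_le` with one more conservation gain.
[cite: BenfattoGiulianiMastropietro2006, §2.8 (2.82)-(2.84), App. A3 Lemma A3.1; BenfattoGiulianiMastropietro2003, §3.1 Lemma 3.1 (4.3)] -/
theorem card_relCount_prescribed_absUmklapp_klAniso_le_frame :
    ∀ μ₁ μ₂ : ℝ, -4 < μ₁ - 4 * klE0 → μ₁ ≤ μ₂ → μ₂ + 4 * klE0 < 0 →
      ∃ κ : ℝ, 0 < κ ∧ ∃ D : ℝ, 0 < D ∧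
      ∀ (K : TrigPolyC4v) (A : ℝ), (∀ p : Momentum, ∀ j ≤ 2, ‖iteratedFDeriv ℝ j (frameShift K) p‖ ≤ A) → 4 * A ≤ κ →
      ∀ μ ∈ Set.Icc μ₁ μ₂, ∀ (L M : ℕ) [NeZero L] (β : ℝ) (m k J' : ℕ),
      ∀ (A'' : Finset (Fin (m + 1) → SectorLeg (sectorCount J'))),
        A'' ⊆ bgmSectorSet L M (klAnisoFamily L M β μ K klE0 J') (m + 1) →
      ∀ (E : Finset (Fin (m + 1))) (τ'' : Fin (m + 1) → SectorLeg (sectorCount J')) (σ' : Fin (m + 1) → SectorLeg (sectorCount k)),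
        E.card + 5 ≤ m + 1 →
      (((A''.filter fun σ'' => (∀ e ∈ E, σ'' e = τ'' e) ∧ ∀ i,
        (∃ q : FreqMomentum L M, klAnisoFamily L M β μ K klE0 J' (σ'' i).1.1 q ≠ 0 ∧
          bgmFatMultiplier L M klE0 β (nambuXiCT L μ K) k (σ' i).1.1 q ≠ 0) ∧
        (σ' i).1.2 = (σ'' i).1.2 ∧ (σ' i).2 = (σ'' i).2).card : ℝ)) ≤
        D ^ (m + 1) * ((2 : ℝ) ^ J') ^ ((m + 1) - E.card - 2) := by
  intro μ₁ μ₂ hμ₁ h12 hμ₂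
  obtain ⟨κ, hκ, D, hD, h⟩ := card_absCount_prescribed_klAniso_le_frame μ₁ μ₂ hμ₁ h12 hμ₂
  refine ⟨κ, hκ, D, hD, ?_⟩
  intro K A hA hAκ μ hμ L M _ β m k J' A'' hA'' E τ'' σ' hE
  refine le_trans ?_ (h K A hA hAκ μ hμ L M β m J' A'' hA'' E τ'' hE)
  exact_mod_cast Finset.card_le_card fun σ'' hσ'' => by
    rw [mem_filter] at hσ'' ⊢
    exact ⟨hσ''.1, hσ''.2.1⟩

end Summit.HubbardSuperconductivity.HubbardSuperconductivity.Theorems.PerturbedFermiCurve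

end
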